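import Literature.AnabelianGeometry.SemiGraphs.TemperedReconstructionR0CompatProofsAt
import Literature.AnabelianGeometry.SemiGraphs.TemperedThm37OfCompactInVerticialAt
import HarnessLib

/-!
# [SemiAnbd] Cor. 3.9 (a) AT ONE PAIR, with Thm. 3.7 (iv) at the TARGET weakened to its two
# locally-finite-true halves (row «COR39b@LOCFIN-SOURCE-FREE», companion file: the (a)-side)

Mochizuki, *Semi-graphs of anabelioids*, Publ. RIMS **42** (2006), §3, Corollary 3.9, proof, manuscript
p. 42 [cite: MochizukiSemiAnbd2006, Cor 3.9 p.42]: "any locally open morphism of semi-graphs of anabelioids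
`G → H` determines a morphism of temperoids `B^temp(G) → B^temp(H)` … whose quasi-geometricity follows by
'substituting' the equivalences of Theorem 3.7, (iv), into Definition 3.8"; Theorem 3.7 (iv) p. 41.

PROOF-ONLY file (abc-iut cell, layer L3, seat abc-iut-L3-t10 gen 8; 0 definitions, no named fact).  The
per-pair step (a) of the cell's Cor. 3.9 chain — abc-iut-L3-d1's `InducedIsQuasiGeometric_of_at`
(`TemperedReconstructionReductionsProofsAt.lean`, block B0a) and abc-iut-w4-d083's `compat_of_compatVAt` /
`isCompatiblyQuasiGeometric_of_compatAt` (`TemperedReconstructionR0CompatProofsAt.lean`, block B5) — takes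
Thm. 3.7 (iii), (iv) at the SOURCE and Thm. 3.7 (iv) at the TARGET as the whole per-graph iff
`MaximalCompactIffVerticialAt ℋ`.  Reading the proofs: at the TARGET only the halves

* (hvm) «verticial ⇒ maximal compact» — `(hmaxℋ _).mpr` (the image host of a verticial subgroup, and the
  two target hosts in the compatibility clause, are maximal compact), and
* (hei) «a nontrivial edge-like subgroup of a closed edge is the intersection of two distinct maximal compact
  subgroups» — `(hintℋ _ _).mpr` (the image of an edge-like subgroup)

are used — both TRUE at every countable locally finite Thm-3.7 graph (abc-iut-w6-d062,
`TemperedMaximalCompactAnchoredOfLocallyFinite.lean`), although the full (iv) fails at e.g. `𝒢_θ`.  This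
file re-proves the three theorems VERBATIM with the target-side input replaced by those two halves
(`InducedIsQuasiGeometric_of_targetHalvesAt`, `compat_of_compatV_targetHalvesAt`,
`isCompatiblyQuasiGeometric_of_compat_targetHalvesAt`; decl suffix `_targetHalvesAt`; source side unchanged;
abc-iut-L3-d1's three private lemmas re-declared privately as in the original At file), plus the
consumer form `isCompatiblyQuasiGeometric_of_compat_of_compactInVerticialAt_source` (source input = Thm. 3.7
(iii) at `𝒢` alone, via abc-iut-w4-d075).  It is the (a)-side mirror of
`TemperedReconstructionVertexEdgeMapSourceHalvesAt.lean` / `…R2bHomSourceHalvesAt.lean` (the (b)-side, source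
halves); assembled in `TemperedReconstructionCor39AsymmetricLocallyFinite.lean`.  Originals untouched;
outside the [IUTchIII] Cor. 3.12 cone; a sharpening of OUR per-pair typing, not a claim about print;
nothing here asserts Thm. 3.7 (iii) for an infinite `𝔾`; typed ≠ proved.
-/

open CategoryTheory Topology

namespace Literature.AnabelianGeometry.SemiGraphs

namespace ProfiniteSemiGraph

universe u

variable {𝒢 ℋ : ProfiniteSemiGraph.{u}}

/-! ### Local copies of the three private lemmas of abc-iut-L3-d1's `TemperedReconstructionReductionsProofsAt` -/

/-- A closed edge has a branch abutting to a vertex. [cite: MochizukiSemiAnbd2006, §1 p.12] -/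
private theorem exists_branch_of_isClosedEdge'' {G : SemiGraph.{u}} {e : G.Edge}
    (he : G.IsClosedEdge e) : ∃ (c : G.Branch) (w : G.Vertex), G.edgeOf c = e ∧ G.abuts c = some w := by
  unfold SemiGraph.IsClosedEdge SemiGraph.vertCard at he
  obtain ⟨x, -, -, -⟩ := Nat.card_eq_two_iff.mp he
  obtain ⟨w, hw⟩ := Option.isSome_iff_exists.mp x.2.2
  exact ⟨x.1, w, x.2.1, hw⟩

/-- A morphism of semi-graphs maps closed edges to closed edges. [cite: MochizukiSemiAnbd2006, §1 p.12] -/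
private theorem isClosedEdge_edgeMap'' {G H : SemiGraph.{u}} (φ : G ⟶ H) {e : G.Edge}
    (he : G.IsClosedEdge e) : H.IsClosedEdge (φ.edgeMap e) := by
  unfold SemiGraph.IsClosedEdge SemiGraph.vertCard at he
  obtain ⟨x, y, hxy, -⟩ := Nat.card_eq_two_iff.mp he
  obtain ⟨w, hw⟩ := Option.isSome_iff_exists.mp x.2.2
  obtain ⟨w', hw'⟩ := Option.isSome_iff_exists.mp y.2.2
  refine SemiGraph.isClosedEdge_of_abuts (c := φ.branchMap x.1) (c' := φ.branchMap y.1)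
    (fun h => hxy (Subtype.ext (φ.branchMap_injOn x.1 y.1 (x.2.1.trans y.2.1.symm) h))) ?_ ?_
    (φ.abuts_branchMap x.1 w hw) (φ.abuts_branchMap y.1 w' hw')
  · rw [φ.edgeOf_branchMap, x.2.1]
  · rw [φ.edgeOf_branchMap, y.2.1]

/-- The image description common to both clauses: from `φ (ψ x) = g * ψ' (η x) * g⁻¹` for all `x`,
`φ(ψ(Π)) = j(η(Π))` with `j = γ_g ∘ ψ'`, and `j(⊤) = γ_g(ψ'(⊤))`. [folklore] -/
private theorem map_range_eq'' {P : Type u} [Group P] {Γ : Type u} [Group Γ] {A B : Type u} [Group A]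
    [Group B] (φ : P →* Γ) (ψ : A →* P) (ψ' : B →* Γ) (η : A →* B) (g : Γ)
    (hg : ∀ x, φ (ψ x) = g * ψ' (η x) * g⁻¹) :
    ψ.range.map φ = η.range.map ((MulAut.conj g).toMonoidHom.comp ψ') ∧
      (⊤ : Subgroup B).map ((MulAut.conj g).toMonoidHom.comp ψ') =
        ψ'.range.map (MulAut.conj g).toMonoidHom := by
  constructor
  · ext y
    constructor
    · rintro ⟨_, ⟨x, rfl⟩, rfl⟩
      exact ⟨η x, ⟨x, rfl⟩, (hg x).symm⟩
    · rintro ⟨_, ⟨x, rfl⟩, rfl⟩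
      exact ⟨ψ x, ⟨x, rfl⟩, hg x⟩
  · rw [MonoidHom.range_eq_map, Subgroup.map_map]

/-! ### Cor. 3.9 (a), literal half, AT the pair: Thm. 3.7 (iv) at the SOURCE, the two halves at the TARGET -/

/-- **R0 at one pair of graphs, from Thm. 3.7 (i), Thm. 3.7 (iv) AT THE SOURCE `𝒢`, and at the TARGET
chart only the two halves (hvm) «verticial ⇒ maximal compact», (hei) «a nontrivial edge-like subgroup of a
closed edge is the intersection of two distinct maximal compact subgroups»** (twin of abc-iut-L3-d1's
`InducedIsQuasiGeometric_of_at`, proof verbatim up to the two target-side call sites `(hmaxℋ _).mpr`,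
`(hintℋ _ _).mpr`): a homomorphism `φ : π₁^temp(G) → π₁^temp(H)` compatible with a locally open `F : G → H`
on verticial and edge homomorphisms is quasi-geometric. [cite: MochizukiSemiAnbd2006, Cor 3.9 p.42] -/
theorem InducedIsQuasiGeometric_of_targetHalvesAt (h37i : VerticialInjective.{u})
    (h37iv𝒢 : MaximalCompactIffVerticialAt 𝒢)
    (h𝒢 : Cor39Hypotheses 𝒢) (hℋ : Cor39Hypotheses ℋ) (c𝒢 : TemperedPiChart 𝒢)
    (cℋ : TemperedPiChart ℋ)
    (hvmℋ : ∀ (w : ℋ.graph.Vertex) (K : Subgroup cℋ.G), K ∈ verticialSubgroups cℋ w →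
      IsMaximalCompactSubgroup K)
    (heiℋ : ∀ (f : ℋ.graph.Edge) (L : Subgroup cℋ.G), ℋ.graph.IsClosedEdge f →
      L ∈ edgeLikeSubgroups cℋ f → L ≠ ⊥ →
        ∃ K₁ K₂ : Subgroup cℋ.G, IsMaximalCompactSubgroup K₁ ∧ IsMaximalCompactSubgroup K₂ ∧
          K₁ ≠ K₂ ∧ L = K₁ ⊓ K₂)
    (F : Hom 𝒢 ℋ) (φ : c𝒢.G →ₜ* cℋ.G) (hF : F.IsLocallyOpen)
    (hV : F.CompatV c𝒢 cℋ φ) (hE : F.CompatE c𝒢 cℋ φ) : IsQuasiGeometric φ := by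
  haveI := cℋ.t2Space
  have h37𝒢 := h𝒢.thm37Hypotheses
  have h37ℋ := hℋ.thm37Hypotheses
  obtain ⟨hmax𝒢, hint𝒢⟩ := h37iv𝒢 h37𝒢 c𝒢
  refine ⟨fun K₁ hK₁ => ?_, fun K₁ H₁ hK₁ hH₁ hne hnt => ?_⟩
  · -- maximal compact subgroups
    obtain ⟨v, ψ, ⟨eψ⟩, rfl⟩ := (hmax𝒢 K₁).mp hK₁
    obtain ⟨⟨_, ψ₁, ⟨e₁⟩, rfl⟩, hinj₁⟩ := h37i ℋ h37ℋ cℋ (F.base.vertexMap v)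
    obtain ⟨g, hg⟩ := hV v ψ ψ₁ ⟨eψ⟩ ⟨e₁⟩
    let j : ℋ.Gv (F.base.vertexMap v) →* cℋ.G := (MulAut.conj g).toMonoidHom.comp ψ₁.toMonoidHom
    have hjc : Continuous j :=
      ((continuous_const.mul ψ₁.continuous).mul continuous_const :)
    have hj : Function.Injective j := fun a b h => hinj₁ ψ₁ ⟨e₁⟩ ((MulAut.conj g).injective h)
    obtain ⟨hK, htop⟩ := map_range_eq'' φ.toMonoidHom ψ.toMonoidHom ψ₁.toMonoidHom
      (F.hV v).toMonoidHom g hg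
    refine ⟨(⊤ : Subgroup _).map j, hvmℋ (F.base.vertexMap v) _ ?_,
      mapsOntoOpenSubgroupOf_of_eq_map j hjc hj φ.toMonoidHom _ _ (hF.1 v) hK⟩
    rw [htop]
    exact conj_mem_verticialSubgroups cℋ ⟨ψ₁, ⟨e₁⟩, rfl⟩ g
  · -- nontrivial intersections of two distinct maximal compact subgroups
    obtain ⟨e, he, ψ, ⟨eψ⟩, hL⟩ := (hint𝒢 (K₁ ⊓ H₁) hnt).mp ⟨K₁, H₁, hK₁, hH₁, hne, rfl⟩
    rw [hL]
    -- a branch `b` of the closed edge `F e`, abutting to `w`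
    have he' : ℋ.graph.IsClosedEdge (F.base.edgeMap e) := isClosedEdge_edgeMap'' F.base he
    obtain ⟨b, w, hbe, hbw⟩ := exists_branch_of_isClosedEdge'' he'
    -- an edge homomorphism at `F e`: `ψ_w ∘ b_*`, injective
    obtain ⟨⟨_, ψw, ⟨ew⟩, rfl⟩, hinjw⟩ := h37i ℋ h37ℋ cℋ w
    have key : ∀ (f : ℋ.graph.Edge) (hf : ℋ.graph.edgeOf b = f), ℋ.graph.IsClosedEdge f →
        ∀ (η : 𝒢.Ge e →ₜ* ℋ.Ge f), IsOpen (η.toMonoidHom.range : Set (ℋ.Ge f)) →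
        (∀ ψ' : ℋ.Ge f →ₜ* cℋ.G, IsEdgeHom cℋ f ψ' → ∃ g : cℋ.G, ∀ x, φ (ψ x) = g * ψ' (η x) * g⁻¹) →
        ∃ K₂ H₂ : Subgroup cℋ.G, IsMaximalCompactSubgroup K₂ ∧ IsMaximalCompactSubgroup H₂ ∧
          K₂ ≠ H₂ ∧ K₂ ⊓ H₂ ≠ ⊥ ∧
          MapsOntoOpenSubgroupOf φ.toMonoidHom ψ.toMonoidHom.range (K₂ ⊓ H₂) := by
      intro f hf hfc η hη hcomp
      subst hf
      let ψ' : ℋ.Ge (ℋ.graph.edgeOf b) →ₜ* cℋ.G := ψw.comp (ℋ.brHom b w hbw)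
      have hψ' : IsEdgeHom cℋ (ℋ.graph.edgeOf b) ψ' := isEdgeHom_comp_brHom cℋ hbw ⟨ew⟩
      have hinj' : Function.Injective ψ' :=
        (hinjw ψw ⟨ew⟩).comp (hℋ.isOfInjectiveType b w hbw)
      obtain ⟨g, hg⟩ := hcomp ψ' hψ'
      let j : ℋ.Ge (ℋ.graph.edgeOf b) →* cℋ.G := (MulAut.conj g).toMonoidHom.comp ψ'.toMonoidHom
      have hjc : Continuous j := ((continuous_const.mul ψ'.continuous).mul continuous_const :)
      have hj : Function.Injective j := fun a a' h => hinj' ((MulAut.conj g).injective h)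
      obtain ⟨hK, htop⟩ := map_range_eq'' φ.toMonoidHom ψ.toMonoidHom ψ'.toMonoidHom
        η.toMonoidHom g hg
      -- the target edge-like subgroup `j(Π_{F e})`, nontrivial
      have hL₂ : (⊤ : Subgroup _).map j ∈ edgeLikeSubgroups cℋ (ℋ.graph.edgeOf b) := by
        rw [htop]
        exact conj_mem_edgeLikeSubgroups' cℋ ⟨ψ', hψ', rfl⟩ g
      haveI : Infinite (ℋ.Gv w) := infinite_gv_of_isElevatedVertex (hℋ.isTotallyElevated w)
      haveI : Nontrivial (ℋ.Ge (ℋ.graph.edgeOf b)) :=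
        nontrivial_ge_of_isAloofEdge hbw (hℋ.isTotallyAloof _)
      have hL₂ne : (⊤ : Subgroup _).map j ≠ ⊥ := by
        intro h0
        obtain ⟨x, hx⟩ := exists_ne (1 : ℋ.Ge (ℋ.graph.edgeOf b))
        have : j x ∈ ((⊤ : Subgroup _).map j) := ⟨x, Subgroup.mem_top x, rfl⟩
        rw [h0, Subgroup.mem_bot, ← map_one j] at this
        exact hx (hj this)
      obtain ⟨K₂, H₂, hK₂, hH₂, hne₂, hKH⟩ := heiℋ _ _ hfc hL₂ hL₂ne
      refine ⟨K₂, H₂, hK₂, hH₂, hne₂, hKH ▸ hL₂ne, ?_⟩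
      rw [← hKH]
      exact mapsOntoOpenSubgroupOf_of_eq_map j hjc hj φ.toMonoidHom _ _ hη hK
    exact key (F.base.edgeMap e) hbe he' (F.hE e) (hF.2 e) fun ψ' hψ' => hE e ψ ψ' ⟨eψ⟩ hψ'

/-! ### Cor. 3.9 (a), compatibility clause, AT the pair: (iii)/(iv) at the SOURCE, «verticial ⇒ maximal
compact» at the TARGET -/

/-- **Cor. 3.9 (a), the compatibility clause, AT the pair `(𝒢, ℋ)`, with Thm. 3.7 (iv) at the TARGET
weakened to the half (hvm) «verticial ⇒ maximal compact»** (twin of abc-iut-w4-d083's `compat_of_compatVAt`,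
proof verbatim up to the target-side call sites `(hmaxℋ _).mpr`): for `φ` compatible with a locally open
`F : G → H` on verticial homomorphisms, two distinct maximal compact subgroups of `π₁^temp(G)` with nontrivial
intersection are carried INTO two distinct maximal compact subgroups of `π₁^temp(H)` — from Thm 3.7 (i),
(ii), Thm 3.7 (iii) and (iv) AT THE SOURCE `𝒢`, and (hvm) at the target chart.
[cite: MochizukiSemiAnbd2006, Cor 3.9 p.42] -/
theorem compat_of_compatV_targetHalvesAt (h37i : VerticialInjective.{u}) (h37ii : VerticialDistinct.{u})
    (h37iii : CompactInVerticialAt 𝒢) (h37iv𝒢 : MaximalCompactIffVerticialAt 𝒢)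
    (h𝒢 : Cor39Hypotheses 𝒢) (hℋ : Cor39Hypotheses ℋ) (c𝒢 : TemperedPiChart 𝒢)
    (cℋ : TemperedPiChart ℋ)
    (hvmℋ : ∀ (w : ℋ.graph.Vertex) (K : Subgroup cℋ.G), K ∈ verticialSubgroups cℋ w →
      IsMaximalCompactSubgroup K)
    (F : Hom 𝒢 ℋ) (φ : c𝒢.G →ₜ* cℋ.G) (hF : F.IsLocallyOpen)
    (hV : F.CompatV c𝒢 cℋ φ) :
    ∀ K₁ H₁ : Subgroup c𝒢.G, IsMaximalCompactSubgroup K₁ → IsMaximalCompactSubgroup H₁ → K₁ ≠ H₁ →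
      K₁ ⊓ H₁ ≠ ⊥ → ∃ K₂ H₂ : Subgroup cℋ.G, IsMaximalCompactSubgroup K₂ ∧ IsMaximalCompactSubgroup H₂ ∧
        K₂ ≠ H₂ ∧ K₁.map φ.toMonoidHom ≤ K₂ ∧ H₁.map φ.toMonoidHom ≤ H₂ := by
  classical
  intro K₁ H₁ hK₁ hH₁ hne hnt
  haveI := TemperedPiChart.t2Space c𝒢
  haveI := TemperedPiChart.t2Space cℋ
  have h𝒢37 := h𝒢.thm37Hypotheses
  have hℋ37 := hℋ.thm37Hypotheses
  obtain ⟨hmax𝒢, hint𝒢⟩ := h37iv𝒢 h𝒢37 c𝒢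
  choose ψ hψ using exists_isVerticialHom_of_thm37i h37i h𝒢37 c𝒢
  choose Ψ hΨ using exists_isVerticialHom_of_thm37i h37i hℋ37 cℋ
  -- `L := K₁ ⊓ H₁` is an edge-like subgroup of a closed edge `e`
  obtain ⟨e, he, hL⟩ := (hint𝒢 (K₁ ⊓ H₁) hnt).mp ⟨K₁, H₁, hK₁, hH₁, hne, rfl⟩
  obtain ⟨b₁, b₂, v₁, v₂, hb12, q₁, q₂, hv₁, hv₂⟩ := SemiGraph.exists_branches_of_isClosedEdge he
  -- `L = gᵢ ψ_{vᵢ}(Π_{bᵢ}) gᵢ⁻¹`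
  obtain ⟨g₁, hLg₁⟩ := edgeLike_eq_map_branchSubgroup c𝒢 hv₁ (q₁ ▸ hL) (ψ v₁) (hψ v₁)
  obtain ⟨g₂, hLg₂⟩ := edgeLike_eq_map_branchSubgroup c𝒢 hv₂ (q₂ ▸ hL) (ψ v₂) (hψ v₂)
  -- the source hosts and the identification `{K₁, H₁} = {V₁, V₂}`
  set V₁ := (ψ v₁).toMonoidHom.range.map (MulAut.conj g₁).toMonoidHom with hV₁def
  set V₂ := (ψ v₂).toMonoidHom.range.map (MulAut.conj g₂).toMonoidHom with hV₂def
  have hV₁ : V₁ ∈ verticialSubgroups c𝒢 v₁ :=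
    conj_mem_verticialSubgroups c𝒢 (range_mem_verticialSubgroups c𝒢 (ψ v₁) (hψ v₁)) g₁
  have hV₂ : V₂ ∈ verticialSubgroups c𝒢 v₂ :=
    conj_mem_verticialSubgroups c𝒢 (range_mem_verticialSubgroups c𝒢 (ψ v₂) (hψ v₂)) g₂
  have hLV₁ : K₁ ⊓ H₁ ≤ V₁ := by rw [hLg₁]; exact Subgroup.map_mono (Subgroup.map_le_range _ _)
  have hLV₂ : K₁ ⊓ H₁ ≤ V₂ := by rw [hLg₂]; exact Subgroup.map_mono (Subgroup.map_le_range _ _)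
  have hVne : V₁ ≠ V₂ := fun hEq =>
    hb12 (branch_eq_of_hosts_eq h37ii h37i h𝒢37 c𝒢 ψ hψ hnt hv₁ hv₂ g₁ g₂ hLg₁.le hLg₂.le hEq)
  have hLc : IsCompact ((K₁ ⊓ H₁ : Subgroup c𝒢.G) : Set c𝒢.G) := by
    rw [Subgroup.coe_inf]; exact hK₁.1.inter_right hH₁.1.isClosed
  obtain ⟨honly, -⟩ := (h37iii h𝒢37 c𝒢 _ hLc).2 hnt v₁ v₂ V₁ V₂ hV₁ hV₂ hVne hLV₁ hLV₂
  obtain ⟨u₁, hK₁u⟩ := (hmax𝒢 K₁).mp hK₁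
  obtain ⟨u₂, hH₁u⟩ := (hmax𝒢 H₁).mp hH₁
  -- the target hosts `Tᵢ = mᵢ Ψ_{F vᵢ}(Π) mᵢ⁻¹` through the branches `F bᵢ`
  have htarget : ∀ {b : 𝒢.graph.Branch} {v : 𝒢.graph.Vertex} (hv : 𝒢.graph.abuts b = some v)
      (q : 𝒢.graph.edgeOf b = e) (g : c𝒢.G),
      K₁ ⊓ H₁ = ((𝒢.branchSubgroup b v hv).map (ψ v).toMonoidHom).map (MulAut.conj g).toMonoidHom →
      ∃ m : cℋ.G,
        ((ψ v).toMonoidHom.range.map (MulAut.conj g).toMonoidHom).map φ.toMonoidHom ≤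
          (Ψ (F.base.vertexMap v)).toMonoidHom.range.map (MulAut.conj m).toMonoidHom ∧
        (K₁ ⊓ H₁).map φ.toMonoidHom ≤
          ((ℋ.branchSubgroup (F.base.branchMap b) (F.base.vertexMap v)
            (F.base.abuts_branchMap b v hv)).map (Ψ (F.base.vertexMap v)).toMonoidHom).map
            (MulAut.conj m).toMonoidHom ∧
        (K₁ ⊓ H₁).map φ.toMonoidHom ≠ ⊥ := by
    intro b v hv q g hLg
    subst q
    obtain ⟨c, hc⟩ := hV v (ψ v) (Ψ (F.base.vertexMap v)) (hψ v) (hΨ _)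
    obtain ⟨γ, hγ⟩ := F.exists_conj b v hv (F.base.edgeMap (𝒢.graph.edgeOf b)) rfl
      (F.base.edgeOf_branchMap b)
    have hγz : ∀ z, γ * ℋ.brHomAt (F.base.branchMap b) (F.base.vertexMap v)
        (F.base.abuts_branchMap b v hv) _ (F.base.edgeOf_branchMap b) (F.hE _ z) * γ⁻¹ =
        F.hV v (𝒢.brHom b v hv z) := fun z => by
      have h := hγ z
      rw [Hom.hEAt_rfl] at h
      exact h
    refine ⟨φ g * c * Ψ (F.base.vertexMap v) γ, ?_, ?_, ?_⟩
    · rintro _ ⟨_, ⟨_, ⟨y, rfl⟩, rfl⟩, rfl⟩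
      refine ⟨Ψ _ (γ⁻¹ * F.hV v y * γ), ⟨γ⁻¹ * F.hV v y * γ, rfl⟩, ?_⟩
      show φ g * c * Ψ (F.base.vertexMap v) γ * Ψ _ (γ⁻¹ * F.hV v y * γ) *
          (φ g * c * Ψ (F.base.vertexMap v) γ)⁻¹ = φ (g * ψ v y * g⁻¹)
      rw [map_mul φ, map_mul φ, map_inv φ, hc y, map_mul (Ψ _), map_mul (Ψ _), map_inv (Ψ _)]
      group
    · rw [hLg]
      rintro _ ⟨_, ⟨_, ⟨_, ⟨z, rfl⟩, rfl⟩, rfl⟩, rfl⟩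
      refine ⟨Ψ _ (ℋ.brHomAt (F.base.branchMap b) (F.base.vertexMap v) (F.base.abuts_branchMap b v hv)
          _ (F.base.edgeOf_branchMap b) (F.hE _ z)), ⟨_, brHomAt_mem_branchSubgroup _ _ _, rfl⟩, ?_⟩
      show φ g * c * Ψ (F.base.vertexMap v) γ * Ψ _ (ℋ.brHomAt (F.base.branchMap b)
          (F.base.vertexMap v) (F.base.abuts_branchMap b v hv) _ (F.base.edgeOf_branchMap b)
          (F.hE _ z)) * (φ g * c * Ψ (F.base.vertexMap v) γ)⁻¹ =
          φ (g * ψ v (𝒢.brHom b v hv z) * g⁻¹)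
      rw [map_mul φ, map_mul φ, map_inv φ, hc, ← hγz z, map_mul (Ψ _), map_mul (Ψ _), map_inv (Ψ _)]
      group
    · -- nontriviality: `F` is locally open, `Π_{F e}` is infinite
      intro h0
      have hopen := hF.2 (𝒢.graph.edgeOf b)
      -- transport along `edgeOf (F b) = F (edgeOf b)` to apply `ne_bot_of_isOpen_ge`
      have key : ∀ (f : ℋ.graph.Edge) (qq : ℋ.graph.edgeOf (F.base.branchMap b) = f)
          (η : 𝒢.Ge (𝒢.graph.edgeOf b) →ₜ* ℋ.Ge f), IsOpen (η.toMonoidHom.range : Set (ℋ.Ge f)) →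
          (∀ z, φ (g * ψ v (𝒢.brHom b v hv z) * g⁻¹) =
            (φ g * c * Ψ _ γ) * Ψ _ (ℋ.brHomAt (F.base.branchMap b) (F.base.vertexMap v)
              (F.base.abuts_branchMap b v hv) f qq (η z)) * (φ g * c * Ψ _ γ)⁻¹) → False := by
        intro f qq η hη hφ
        subst qq
        apply ne_bot_of_isOpen_ge hℋ37.toProp36Hypotheses (F.base.abuts_branchMap b v hv) hη
        rw [eq_bot_iff]
        rintro _ ⟨z, rfl⟩
        have hz : φ (g * ψ v (𝒢.brHom b v hv z) * g⁻¹) ∈ (K₁ ⊓ H₁).map φ.toMonoidHom :=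
          ⟨_, hLg ▸ ⟨_, ⟨_, ⟨z, rfl⟩, rfl⟩, rfl⟩, rfl⟩
        rw [h0, Subgroup.mem_bot, hφ z] at hz
        have h1 : Ψ _ (ℋ.brHomAt (F.base.branchMap b) (F.base.vertexMap v)
            (F.base.abuts_branchMap b v hv) _ rfl (η z)) = 1 := by
          have := hz; rw [mul_inv_eq_one, mul_eq_left] at this; exact this
        have h2 := (h37i ℋ hℋ37 cℋ _).2 (Ψ _) (hΨ _) (by rw [h1, map_one] : Ψ _ _ = Ψ _ 1)
        have h3 := brHomAt_injective hℋ.isOfInjectiveType (F.base.abuts_branchMap b v hv) rfl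
          (by rw [h2, map_one] : ℋ.brHomAt _ _ _ _ rfl (η z) = ℋ.brHomAt _ _ _ _ rfl 1)
        exact h3
      refine key _ (F.base.edgeOf_branchMap b) (F.hE _) hopen fun z => ?_
      rw [map_mul φ, map_mul φ, map_inv φ, hc, ← hγz z, map_mul (Ψ _), map_mul (Ψ _), map_inv (Ψ _)]
      group
  obtain ⟨m₁, hT₁, hLT₁, hLne⟩ := htarget hv₁ q₁ g₁ hLg₁
  obtain ⟨m₂, hT₂, hLT₂, -⟩ := htarget hv₂ q₂ g₂ hLg₂
  -- the target hosts are distinct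
  have hTne : (Ψ (F.base.vertexMap v₁)).toMonoidHom.range.map (MulAut.conj m₁).toMonoidHom ≠
      (Ψ (F.base.vertexMap v₂)).toMonoidHom.range.map (MulAut.conj m₂).toMonoidHom := fun hEq =>
    hb12 (F.base.branchMap_injOn b₁ b₂ (q₁.trans q₂.symm)
      (branch_eq_of_hosts_eq h37ii h37i hℋ37 cℋ Ψ hΨ hLne (F.base.abuts_branchMap b₁ v₁ hv₁)
        (F.base.abuts_branchMap b₂ v₂ hv₂) m₁ m₂ hLT₁ hLT₂ hEq))
  have hT₁m : (Ψ (F.base.vertexMap v₁)).toMonoidHom.range.map (MulAut.conj m₁).toMonoidHom ∈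
      verticialSubgroups cℋ (F.base.vertexMap v₁) :=
    conj_mem_verticialSubgroups cℋ (range_mem_verticialSubgroups cℋ (Ψ _) (hΨ _)) m₁
  have hT₂m : (Ψ (F.base.vertexMap v₂)).toMonoidHom.range.map (MulAut.conj m₂).toMonoidHom ∈
      verticialSubgroups cℋ (F.base.vertexMap v₂) :=
    conj_mem_verticialSubgroups cℋ (range_mem_verticialSubgroups cℋ (Ψ _) (hΨ _)) m₂
  -- `K₁`, `H₁` are `V₁`, `V₂` in some order
  rcases honly u₁ K₁ hK₁u inf_le_left with hK1 | hK2 <;>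
    rcases honly u₂ H₁ hH₁u inf_le_right with hH1 | hH2
  · exact absurd (hK1.trans hH1.symm) hne
  · exact ⟨_, _, hvmℋ _ _ hT₁m, hvmℋ _ _ hT₂m, hTne, hK1 ▸ hT₁, hH2 ▸ hT₂⟩
  · exact ⟨_, _, hvmℋ _ _ hT₂m, hvmℋ _ _ hT₁m, hTne.symm, hK2 ▸ hT₂, hH1 ▸ hT₁⟩
  · exact absurd (hK2.trans hH2.symm) hne


/-- **Cor. 3.9 (a) under the compatible reading of Def. 3.8, AT the pair `(𝒢, ℋ)`, with Thm. 3.7 (iii),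
(iv) AT THE SOURCE and only the two halves (hvm), (hei) AT THE TARGET** (twin of abc-iut-w4-d083's
`isCompatiblyQuasiGeometric_of_compatAt` WITHOUT `MaximalCompactIffVerticialAt ℋ`): a homomorphism
compatible with a locally open morphism of semi-graphs of anabelioids on verticial and edge homomorphisms is
COMPATIBLY quasi-geometric. [cite: MochizukiSemiAnbd2006, Cor 3.9 p.42] -/
theorem isCompatiblyQuasiGeometric_of_compat_targetHalvesAt (h37i : VerticialInjective.{u})
    (h37ii : VerticialDistinct.{u}) (h37iii : CompactInVerticialAt 𝒢)
    (h37iv𝒢 : MaximalCompactIffVerticialAt 𝒢)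
    (h𝒢 : Cor39Hypotheses 𝒢) (hℋ : Cor39Hypotheses ℋ)
    (c𝒢 : TemperedPiChart 𝒢) (cℋ : TemperedPiChart ℋ)
    (hvmℋ : ∀ (w : ℋ.graph.Vertex) (K : Subgroup cℋ.G), K ∈ verticialSubgroups cℋ w →
      IsMaximalCompactSubgroup K)
    (heiℋ : ∀ (f : ℋ.graph.Edge) (L : Subgroup cℋ.G), ℋ.graph.IsClosedEdge f →
      L ∈ edgeLikeSubgroups cℋ f → L ≠ ⊥ →
        ∃ K₁ K₂ : Subgroup cℋ.G, IsMaximalCompactSubgroup K₁ ∧ IsMaximalCompactSubgroup K₂ ∧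
          K₁ ≠ K₂ ∧ L = K₁ ⊓ K₂)
    (F : Hom 𝒢 ℋ) (φ : c𝒢.G →ₜ* cℋ.G)
    (hF : F.IsLocallyOpen) (hV : F.CompatV c𝒢 cℋ φ) (hE : F.CompatE c𝒢 cℋ φ) :
    IsCompatiblyQuasiGeometric φ :=
  ⟨InducedIsQuasiGeometric_of_targetHalvesAt h37i h37iv𝒢 h𝒢 hℋ c𝒢 cℋ hvmℋ heiℋ F φ hF hV hE,
    compat_of_compatV_targetHalvesAt h37i h37ii h37iii h37iv𝒢 h𝒢 hℋ c𝒢 cℋ hvmℋ F φ hF hV⟩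

/-- The same with the source inputs reduced to Thm. 3.7 (iii) AT THE SOURCE alone ((iv) at `𝒢` from (iii)
at `𝒢` by abc-iut-w4-d075's `maximalCompactIffVerticialAt_of_compactInVerticialAt`; (i), (ii) theorems of
the tree). [cite: MochizukiSemiAnbd2006, Cor 3.9 p.42] -/
theorem isCompatiblyQuasiGeometric_of_compat_of_compactInVerticialAt_source
    (h𝒢iii : CompactInVerticialAt 𝒢) (h𝒢 : Cor39Hypotheses 𝒢) (hℋ : Cor39Hypotheses ℋ)
    (c𝒢 : TemperedPiChart 𝒢) (cℋ : TemperedPiChart ℋ)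
    (hvmℋ : ∀ (w : ℋ.graph.Vertex) (K : Subgroup cℋ.G), K ∈ verticialSubgroups cℋ w →
      IsMaximalCompactSubgroup K)
    (heiℋ : ∀ (f : ℋ.graph.Edge) (L : Subgroup cℋ.G), ℋ.graph.IsClosedEdge f →
      L ∈ edgeLikeSubgroups cℋ f → L ≠ ⊥ →
        ∃ K₁ K₂ : Subgroup cℋ.G, IsMaximalCompactSubgroup K₁ ∧ IsMaximalCompactSubgroup K₂ ∧
          K₁ ≠ K₂ ∧ L = K₁ ⊓ K₂)
    (F : Hom 𝒢 ℋ) (φ : c𝒢.G →ₜ* cℋ.G)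
    (hF : F.IsLocallyOpen) (hV : F.CompatV c𝒢 cℋ φ) (hE : F.CompatE c𝒢 cℋ φ) :
    IsCompatiblyQuasiGeometric φ :=
  isCompatiblyQuasiGeometric_of_compat_targetHalvesAt verticialInjective_holds verticialDistinct_holds h𝒢iii
    (maximalCompactIffVerticialAt_of_compactInVerticialAt h𝒢iii) h𝒢 hℋ c𝒢 cℋ hvmℋ heiℋ F φ hF hV hE

end ProfiniteSemiGraph

end Literature.AnabelianGeometry.SemiGraphs
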